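import Literature.Computability.Cryptography.HallgrenClassGroupCipollaFP
import Literature.Computability.Cryptography.HallgrenClassGroupIdealEnumerationMachine
import HarnessLib

/-!
# Root slots: from Cipolla's verified roots to the canonical roots `primeRoot`, per prime of `a`

Glue between the randomised root finder (`HallgrenClassGroupCipollaFP.lean`: `Cipolla.rootSearch`)
and the machine ideal enumeration (`HallgrenClassGroupIdealEnumerationMachine.lean`: `withRoots`,
`twQuery`), for the torsion-witness oracle of the imaginary branch of the `3 ∣ h` algorithm. For
`D = −d` and a prime `q` the enumeration needs the CANONICAL root `primeRoot D q` = the least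
`β ∈ [0, 2q)` with `4q ∣ β² − D`; a machine cannot scan `[0, 2q)`, but

* from ANY square root `u` of `D (mod q)` the valid `β` are among the four sorted candidates
  `[min(v, q−v), max(v, q−v), q + min, q + max]`, `v = u mod q` (`candidates`, `mem_candidates_of_dvd`),
  and for `q = 2` among `[0, 1, 2, 3]`; so `pickRoot D q r` = the first valid candidate IS `primeRoot D q`
  as soon as the candidates cover the valid `β` (`find?_eq_primeRoot_of_cover`, `pickRoot_eq_primeRoot`);
* `slotRoot q d B` = `some 0` if `q ∣ d`, else Cipolla's `rootSearch` on the coin blocks `B` with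
  `n = −d (mod q)`; on the event `Good d q B` ("if `−d` is a non-zero residue mod the odd prime `q`, the
  search succeeded") we get **`pickRoot_slotRoot`**: `pickRoot (−d) q (slotRoot q d B) = primeRoot (−d) q`;
* `slotList d F Bs` zips the distinct primes of `F = primeFactorsList a` (with their multiplicities
  `F.count q = v_q(a)`, `dedup_primeFactorsList`, `count_primeFactorsList`) with the picked roots;
  **`slotList_eq_withRoots`**: on the good event for every slot,
  `slotList d (primeFactorsList a) Bs = withRoots (−d) (factorPairs a)`;
* the bad event of one slot has probability `≤ (3/4)^m` (`uniformProb_not_good_le`).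

## References

* H. Cohen, *A Course in Computational Algebraic Number Theory*, GTM 138, Springer 1993, §1.5, §5.2
  [Cohen1993].
* R. Crandall, C. Pomerance, *Prime Numbers: A Computational Perspective*, Springer, §2.3.2
  [CrandallPomerance1999].
-/

namespace Literature.Computability.Cryptography.Hallgren2005

namespace RootSlots

open Cipolla FormComposition _root_.Computability Literature.Computability.Complexity

/-! ### Candidates and the picked root -/

/-- The sorted candidate list for the canonical root: all of `[0, 4)` for `q = 2`, else the four lifts
`±u (mod q)` in `[0, 2q]` of a square root `u`. [cite: Cohen1993, §5.2] -/
def candidates (q : ℕ) (r : Option ℕ) : List ℕ :=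
  if q = 2 then [0, 1, 2, 3] else
    match r with
    | none => []
    | some u => [min (u % q) (q - u % q), max (u % q) (q - u % q), q + min (u % q) (q - u % q),
        q + max (u % q) (q - u % q)]

/-- Validity of a candidate: `β < 2q` and `4q ∣ β² − D`. [cite: Cohen1993, §5.2] -/
def validRoot (D : ℤ) (q β : ℕ) : Bool := decide (β < 2 * q) && decide ((4 * (q : ℤ)) ∣ (β : ℤ) ^ 2 - D)

/-- The picked root: the first valid candidate. [cite: Cohen1993, §5.2] -/
def pickRoot (D : ℤ) (q : ℕ) (r : Option ℕ) : Option ℕ := (candidates q r).find? (validRoot D q)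

/-- `validRoot` unfolded. [folklore] -/
theorem validRoot_eq_true {D : ℤ} {q β : ℕ} :
    validRoot D q β = true ↔ β < 2 * q ∧ (4 * (q : ℤ)) ∣ (β : ℤ) ^ 2 - D := by
  simp [validRoot]

/-- The candidate list is sorted (`q > 0`). [folklore] -/
theorem candidates_sorted {q : ℕ} (hq : 0 < q) (r : Option ℕ) : (candidates q r).Pairwise (· ≤ ·) := by
  unfold candidates
  split_ifs with h
  · decide
  · cases r with
    | none => exact List.Pairwise.nil
    | some u =>
      have hvq : u % q < q := Nat.mod_lt _ hq
      dsimp only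
      rcases le_total (u % q) (q - u % q) with hle | hle
      · rw [min_eq_left hle, max_eq_right hle]
        simp only [List.pairwise_cons, List.mem_cons, List.not_mem_nil, or_false, forall_eq_or_imp, forall_eq,
          List.Pairwise.nil, and_true]
        exact ⟨⟨hle, by omega, by omega⟩, ⟨by omega, by omega⟩, by omega, fun _ h => h.elim⟩
      · rw [min_eq_right hle, max_eq_left hle]
        simp only [List.pairwise_cons, List.mem_cons, List.not_mem_nil, or_false, forall_eq_or_imp, forall_eq,
          List.Pairwise.nil, and_true]
        exact ⟨⟨hle, by omega, by omega⟩, ⟨by omega, by omega⟩, by omega, fun _ h => h.elim⟩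

/-- **The first valid element of a sorted covering list is the canonical root.** [cite: Cohen1993, §5.2] -/
theorem find?_eq_primeRoot_of_cover {D : ℤ} {q : ℕ} {C : List ℕ} (hC : C.Pairwise (· ≤ ·))
    (hcov : ∀ β : ℕ, β < 2 * q → (4 * (q : ℤ)) ∣ (β : ℤ) ^ 2 - D → β ∈ C) :
    C.find? (validRoot D q) = primeRoot D q := by
  rcases h : C.find? (validRoot D q) with _ | β
  · symm
    rw [primeRoot_eq_none_iff]
    intro β hβ hdvd
    have := (List.find?_eq_none.1 h) β (hcov β hβ hdvd)
    rw [validRoot_eq_true] at this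
    exact this ⟨hβ, hdvd⟩
  · symm
    rw [primeRoot_eq_some_iff]
    obtain ⟨hv, as, bs, hCeq, has⟩ := List.find?_eq_some_iff_append.1 h
    rw [validRoot_eq_true] at hv
    refine ⟨hv.1, hv.2, fun γ hγ hdvd => ?_⟩
    have hγC := hcov γ (hγ.trans hv.1) hdvd
    rw [hCeq, List.mem_append, List.mem_cons] at hγC
    rcases hγC with hm | rfl | hm
    · have := has γ hm
      rw [Bool.not_eq_true', ← Bool.not_eq_true, validRoot_eq_true] at this
      exact this ⟨hγ.trans hv.1, hdvd⟩
    · exact lt_irrefl _ hγ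
    · rw [hCeq, List.pairwise_append] at hC
      have hβγ : β ≤ γ := (List.pairwise_cons.1 hC.2.1).1 γ hm
      omega

/-- Coverage for `q = 2`: every `β < 4` is a candidate. [folklore] -/
theorem mem_candidates_two {β : ℕ} (hβ : β < 2 * 2) (r : Option ℕ) : β ∈ candidates 2 r := by
  unfold candidates
  rw [if_pos rfl]
  simp only [List.mem_cons, List.not_mem_nil, or_false]
  omega

/-- **Coverage from a square root**: for an odd prime `q` and `u² ≡ D (mod q)`, every `β < 2q` with
`4q ∣ β² − D` is `≡ ±u (mod q)`, hence one of the four candidates. [cite: Cohen1993, §1.5, §5.2] -/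
theorem mem_candidates_of_dvd {D : ℤ} {q : ℕ} (hq : q.Prime) (hq2 : q ≠ 2) {u : ℕ}
    (hu : (q : ℤ) ∣ (u : ℤ) ^ 2 - D) {β : ℕ} (hβ : β < 2 * q) (hdvd : (4 * (q : ℤ)) ∣ (β : ℤ) ^ 2 - D) :
    β ∈ candidates q (some u) := by
  unfold candidates
  rw [if_neg hq2]
  have hvq : u % q < q := Nat.mod_lt _ hq.pos
  have hvu : (q : ℤ) ∣ ((u % q : ℕ) : ℤ) ^ 2 - (u : ℤ) ^ 2 := by
    have h2 : (q : ℤ) ∣ ((u % q : ℕ) : ℤ) - u := by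
      have hdm : (q : ℤ) * ((u / q : ℕ) : ℤ) + ((u % q : ℕ) : ℤ) = u := by exact_mod_cast Nat.div_add_mod u q
      exact ⟨-((u / q : ℕ) : ℤ), by linear_combination hdm⟩
    exact (Dvd.dvd.mul_right h2 _).trans (by rw [sq_sub_sq, mul_comm])
  have hqβ : (q : ℤ) ∣ (β : ℤ) ^ 2 - D := (dvd_mul_left (q : ℤ) 4).trans hdvd
  have hprod : (q : ℤ) ∣ ((β : ℤ) - (u % q : ℕ)) * ((β : ℤ) + (u % q : ℕ)) := by
    have : ((β : ℤ) - (u % q : ℕ)) * ((β : ℤ) + (u % q : ℕ)) =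
        ((β : ℤ) ^ 2 - D) - (((u % q : ℕ) : ℤ) ^ 2 - (u : ℤ) ^ 2) - ((u : ℤ) ^ 2 - D) := by ring
    rw [this]
    exact dvd_sub (dvd_sub hqβ hvu) hu
  have hqp : Prime (q : ℤ) := Nat.prime_iff_prime_int.1 hq
  have hq0 : (0 : ℤ) < q := by exact_mod_cast hq.pos
  simp only [List.mem_cons, List.not_mem_nil, or_false]
  rcases hqp.dvd_or_dvd hprod with ⟨k, hk⟩ | ⟨k, hk⟩
  · -- `β = v + q k` with `k ∈ {0, 1}`
    have hk0 : 0 ≤ k := by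
      by_contra hneg
      push Not at hneg
      have : (q : ℤ) * k ≤ (q : ℤ) * (-1) := mul_le_mul_of_nonneg_left (by omega) hq0.le
      omega
    have hk1 : k ≤ 1 := by
      by_contra hbig
      push Not at hbig
      have : (q : ℤ) * 2 ≤ (q : ℤ) * k := mul_le_mul_of_nonneg_left (by omega) hq0.le
      omega
    obtain rfl | rfl : k = 0 ∨ k = 1 := by omega
    · rw [mul_zero, sub_eq_zero] at hk
      have : β = u % q := by exact_mod_cast hk
      omega
    · rw [mul_one] at hk
      have : β = q + u % q := by omega
      omega
  · -- `β = -v + q k` with `k ∈ {0, 1, 2}`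
    have hk0 : 0 ≤ k := by
      by_contra hneg
      push Not at hneg
      have : (q : ℤ) * k ≤ (q : ℤ) * (-1) := mul_le_mul_of_nonneg_left (by omega) hq0.le
      omega
    have hk2 : k ≤ 2 := by
      by_contra hbig
      push Not at hbig
      have : (q : ℤ) * 3 ≤ (q : ℤ) * k := mul_le_mul_of_nonneg_left (by omega) hq0.le
      omega
    obtain rfl | rfl | rfl : k = 0 ∨ k = 1 ∨ k = 2 := by omega
    · rw [mul_zero] at hk
      omega
    · rw [mul_one] at hk
      omega
    · omega

/-- Coverage when `D` is a non-residue: there is no valid `β` at all. [folklore] -/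
theorem not_dvd_of_not_isSquare {D : ℤ} {q : ℕ} (hD : ¬ IsSquare ((D : ZMod q))) (β : ℕ) :
    ¬ (4 * (q : ℤ)) ∣ (β : ℤ) ^ 2 - D := by
  intro h
  have hq : (q : ℤ) ∣ (β : ℤ) ^ 2 - D := (dvd_mul_left (q : ℤ) 4).trans h
  refine hD ⟨(β : ZMod q), ?_⟩
  have := (ZMod.intCast_zmod_eq_zero_iff_dvd _ q).2 hq
  push_cast at this
  rw [← sq]
  linear_combination -this

/-- **The picked root is the canonical root** whenever the candidates cover the valid `β`.
[cite: Cohen1993, §5.2] -/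
theorem pickRoot_eq_primeRoot {D : ℤ} {q : ℕ} (hq : 0 < q) {r : Option ℕ}
    (hcov : ∀ β : ℕ, β < 2 * q → (4 * (q : ℤ)) ∣ (β : ℤ) ^ 2 - D → β ∈ candidates q r) :
    pickRoot D q r = primeRoot D q :=
  find?_eq_primeRoot_of_cover (candidates_sorted hq r) hcov

/-! ### The slot root and the good event -/

/-- The root datum of the slot of the prime `q`: `0` if `q ∣ d`, else Cipolla's search for `√(−d)`.
[cite: CrandallPomerance1999, §2.3.2] -/
def slotRoot (q d : ℕ) (B : List (List Bool)) : Option ℕ :=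
  if d % q = 0 then some 0 else rootSearch q ((q - d % q) % q) B

/-- **The good event of a slot**: if `−d` is a non-zero residue modulo the odd prime `q`, the search
succeeded. [folklore] -/
def Good (d q : ℕ) (B : List (List Bool)) : Prop :=
  q ≠ 2 → ¬ q ∣ d → IsSquare (-(d : ZMod q)) → rootSearch q ((q - d % q) % q) B ≠ none

/-- The residue `n = (q − d mod q) mod q` is `−d (mod q)`. [folklore] -/
theorem natCast_negMod (q d : ℕ) [NeZero q] : (((q - d % q) % q : ℕ) : ZMod q) = -(d : ZMod q) := by
  have h : d % q ≤ q := (Nat.mod_lt d (Nat.pos_of_ne_zero (NeZero.ne q))).le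
  rw [ZMod.natCast_mod, Nat.cast_sub h, ZMod.natCast_self, ZMod.natCast_mod, zero_sub]

/-- **On the good event the picked root of the slot is the canonical root of `−d`.**
[cite: Cohen1993, §5.2] -/
theorem pickRoot_slotRoot {q : ℕ} (hq : q.Prime) (d : ℕ) {B : List (List Bool)} (hgood : Good d q B) :
    pickRoot (-(d : ℤ)) q (slotRoot q d B) = primeRoot (-(d : ℤ)) q := by
  haveI : Fact q.Prime := ⟨hq⟩
  refine pickRoot_eq_primeRoot hq.pos fun β hβ hdvd => ?_
  by_cases hq2 : q = 2
  · subst hq2; exact mem_candidates_two hβ _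
  unfold slotRoot
  by_cases hd : d % q = 0
  · rw [if_pos hd]
    refine mem_candidates_of_dvd hq hq2 ?_ hβ hdvd
    have : (q : ℤ) ∣ (d : ℤ) := by exact_mod_cast Nat.dvd_of_mod_eq_zero hd
    simpa using this
  · rw [if_neg hd]
    rcases hs : rootSearch q ((q - d % q) % q) B with _ | u
    · exfalso
      have hnd : ¬ q ∣ d := fun h => hd (Nat.mod_eq_zero_of_dvd h)
      refine not_dvd_of_not_isSquare (q := q) (D := -(d : ℤ)) (fun hsq => ?_) β hdvd
      push_cast at hsq
      exact hgood hq2 hnd hsq hs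
    · obtain ⟨-, hver⟩ := rootSearch_eq_some hq.pos hs
      refine mem_candidates_of_dvd hq hq2 ?_ hβ hdvd
      have h1 : ((u * u : ℕ) : ZMod q) = (((q - d % q) % q : ℕ) : ZMod q) :=
        (ZMod.natCast_eq_natCast_iff' _ _ q).2 hver
      rw [natCast_negMod] at h1
      push_cast at h1
      have h2 : (((u : ℤ) ^ 2 - -(d : ℤ) : ℤ) : ZMod q) = 0 := by push_cast; rw [sq, h1]; ring
      exact (ZMod.intCast_zmod_eq_zero_iff_dvd _ q).1 h2

/-! ### The slot list -/

/-- The entry of a slot: `(q, v_q, picked root)`. [folklore] -/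
def slotEntry (d : ℕ) (F : List ℕ) (q : ℕ) (B : List (List Bool)) : ℕ × ℕ × Option ℕ :=
  (q, F.count q, pickRoot (-(d : ℤ)) q (slotRoot q d B))

/-- **The slot list**: the distinct primes of `F` with multiplicities and picked roots. [folklore] -/
def slotList (d : ℕ) (F : List ℕ) (Bs : List (List (List Bool))) : List (ℕ × ℕ × Option ℕ) :=
  List.zipWith (slotEntry d F) F.dedup Bs

/-- The distinct prime factors in increasing order are the deduplicated factor list. [folklore] -/
theorem dedup_primeFactorsList (a : ℕ) : a.primeFactorsList.dedup = a.primeFactors.sort (· ≤ ·) := by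
  have hs : a.primeFactorsList.dedup.Pairwise (· ≤ ·) :=
    (Nat.primeFactorsList_sorted a).pairwise.sublist (List.dedup_sublist _)
  have hn : a.primeFactorsList.dedup.Nodup := List.nodup_dedup _
  have h := (List.toFinset_sort (r := (· ≤ ·)) hn).2 hs
  rw [← h]
  congr 1
  ext q
  rw [List.mem_toFinset, List.mem_dedup, Nat.mem_primeFactors_iff_mem_primeFactorsList]

/-- Multiplicities: `count q (primeFactorsList a) = v_q(a)`. [folklore] -/
theorem count_primeFactorsList (a q : ℕ) : a.primeFactorsList.count q = a.factorization q :=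
  (Nat.primeFactorsList_count_eq).symm ▸ rfl

/-- **On the good event for every slot, the slot list is the canonically decorated prime-power list.**
[cite: Cohen1993, §5.2] -/
theorem slotList_eq_withRoots (a d : ℕ) {Bs : List (List (List Bool))}
    (hlen : Bs.length = a.primeFactorsList.dedup.length)
    (hgood : ∀ (i : ℕ) (hi : i < a.primeFactorsList.dedup.length),
      Good d (a.primeFactorsList.dedup[i]) (Bs[i]'(hlen ▸ hi))) :
    slotList d a.primeFactorsList Bs = withRoots (-(d : ℤ)) (factorPairs a) := by
  have hwr : withRoots (-(d : ℤ)) (factorPairs a) =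
      a.primeFactorsList.dedup.map fun q => (q, a.factorization q, primeRoot (-(d : ℤ)) q) := by
    rw [withRoots, factorPairs, List.map_map, dedup_primeFactorsList]
    rfl
  rw [hwr, slotList]
  refine List.ext_getElem (by rw [List.length_zipWith, List.length_map, hlen, min_self]) fun i h1 h2 => ?_
  rw [List.length_zipWith] at h1
  have hi : i < a.primeFactorsList.dedup.length := lt_of_lt_of_le h1 (min_le_left _ _)
  rw [List.getElem_zipWith, List.getElem_map]
  have hq : (a.primeFactorsList.dedup[i]).Prime :=
    Nat.prime_of_mem_primeFactorsList (List.dedup_sublist _ |>.subset (List.getElem_mem hi))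
  simp only [slotEntry, count_primeFactorsList, pickRoot_slotRoot hq d (hgood i hi)]

/-! ### The bad event of a slot is rare -/

/-- **The bad event of one slot has probability `≤ (3/4)^m`** over its `m` blocks of `μ ≥ log₂ (8q)`
coins. [cite: CrandallPomerance1999, §2.3.2] -/
theorem uniformProb_not_good_le {q : ℕ} (hq : q.Prime) (d : ℕ) {μ : ℕ} (hμ : 8 * q ≤ 2 ^ μ) (m : ℕ) :
    uniformProb (m * μ) {blk | ¬ Good d q ((List.range m).map fun i => (blk.drop (i * μ)).take μ)} ≤ (3 / 4 : ℝ) ^ m := by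
  haveI : Fact q.Prime := ⟨hq⟩
  by_cases hq2 : q = 2
  · refine le_trans (le_of_eq ?_) (by positivity)
    rw [show {blk : List Bool | ¬ Good d q ((List.range m).map fun i => (blk.drop (i * μ)).take μ)} = ∅ from ?_]
    · simp [uniformProb]
    · ext blk; simp [Good, hq2]
  by_cases hqd : q ∣ d
  · refine le_trans (le_of_eq ?_) (by positivity)
    rw [show {blk : List Bool | ¬ Good d q ((List.range m).map fun i => (blk.drop (i * μ)).take μ)} = ∅ from ?_]
    · simp [uniformProb]
    · ext blk; simp [Good, hqd]
  by_cases hsq : IsSquare (-(d : ZMod q))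
  · have hn : IsSquare ((((q - d % q) % q : ℕ)) : ZMod q) := by rwa [natCast_negMod]
    have hn0 : ((((q - d % q) % q : ℕ)) : ZMod q) ≠ 0 := by
      rw [natCast_negMod, neg_ne_zero, Ne, ZMod.natCast_eq_zero_iff]
      exact hqd
    refine le_trans (BlockRejection.uniformProb_mono_len fun blk _ hb => ?_)
      (uniformProb_rootSearch_none_le hq2 hn hn0 hμ m)
    simp only [Set.mem_setOf_eq, Good, Classical.not_imp, Ne] at hb
    exact not_not.1 hb.2.2.2
  · refine le_trans (le_of_eq ?_) (by positivity)
    rw [show {blk : List Bool | ¬ Good d q ((List.range m).map fun i => (blk.drop (i * μ)).take μ)} = ∅ from ?_]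
    · simp [uniformProb]
    · ext blk; simp [Good, hsq]

end RootSlots

end Literature.Computability.Cryptography.Hallgren2005
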